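import Literature.AlgebraicGeometry.Modules.FrameTransition
import Literature.AlgebraicGeometry.Modules.UnitCocycle
import Literature.AlgebraicGeometry.Modules.LocallyFreeTrace
import HarnessLib

/-!
# The determinant cocycle of a finite locally free `𝒪_X`-module

For a finite locally free `𝒪_X`-module `E` on a scheme `X`
(`Literature.AlgebraicGeometry.Motives.IsFiniteLocallyFree`) we define its **determinant class**
`detClass hE : CechPic X` in the Čech Picard group `Ȟ¹(X, 𝒪_X^×)` of `Modules/UnitCocycle.lean`:
choose a frame `𝒪^{I_x} ≅ E|_{U_x}` at every point (`Modules/LocallyFreeTrace.lean`, `trivFrame`)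
and an enumeration `I_x ≃ Fin n_x`, and take the cocycle of determinants of transition matrices
`g_{xy} = det T(e_x, e_y)` (`Modules/FrameTransition.lean`, `transitionDet`). This is the class of
the determinant line bundle `det E = Λ^{rk E} E` (Hartshorne II Ex. 5.16 (d), (e): the transition
functions of `Λ^n E` are the determinants of those of `E`; Ex. 6.11 for `det : K(X) → Pic X`), in
the cocycle language, which needs neither exterior powers of sheaves nor a constant rank.

* `FrameSystem E` — frames of `E` at all points with enumerated index types; `FrameSystem.cocycle`;
* `FrameSystem.cocycle_equiv` — **any two frame systems give cohomologous cocycles** (the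
  coboundary is `λ_x = det T(e'_x, e_x)`);
* `frameSystemOfIsFiniteLocallyFree hE`, `detCocycle hE`, `detClass hE`, and
  `detClass_eq_mk (F : FrameSystem E) : detClass hE = CechPic.mk F.cocycle`.

Additivity of `detClass` on short exact sequences is `Modules/DeterminantCocycleExact.lean`; the
resulting homomorphism `K₀(X) → CechPic X` is `KTheory/Determinant.lean`. Everything is proved; no
named facts.

## References

* R. Hartshorne, *Algebraic Geometry*, GTM 52 (1977), II Ex. 5.16, II Ex. 6.11, III Ex. 4.5.
  [Hartshorne1977]
* W. Fulton, *Intersection theory*, 2nd ed. (1998), §15.1. [Fulton1998]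
-/

noncomputable section

open CategoryTheory AlgebraicGeometry Opposite TopologicalSpace Limits

namespace Literature.AlgebraicGeometry.Modules

open Literature.AlgebraicGeometry.Motives

universe u

variable {X : Scheme.{u}} {E : X.Modules}

/-! ### Frame systems -/

variable (E) in
/-- **A frame system** of an `𝒪_X`-module: at every point `x` an open neighbourhood `U_x`, a finite
index type `I_x` enumerated by `Fin n_x`, and a trivialisation `𝒪^{I_x} ≅ E|_{U_x}`. [folklore] -/
structure FrameSystem where
  /-- The open neighbourhood `U_x` of `x`. -/
  U : X → X.Opens
  /-- `x ∈ U_x`. -/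
  mem : ∀ x, x ∈ U x
  /-- The index type of the frame at `x`. -/
  I : X → Type u
  /-- The size `n_x` of the frame at `x`. -/
  rank : X → ℕ
  /-- The enumeration `I_x ≃ Fin n_x`. -/
  enum : ∀ x, I x ≃ Fin (rank x)
  /-- The frame `𝒪^{I_x} ≅ E|_{U_x}`. -/
  frame : ∀ x, SheafOfModules.free (I x) ≅ E.over (U x)

namespace FrameSystem

variable (F F' : FrameSystem E)

/-- **The determinant cocycle of a frame system**: `g_{xy} = det T(e_x, e_y)` over every open
`V ≤ U_x ⊓ U_y` (Hartshorne II Ex. 5.16 (d)). [cite: Hartshorne1977, II Ex. 5.16] -/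
def cocycle : UnitCocycle X where
  U := F.U
  mem := F.mem
  g x y _ hx hy :=
    transitionDet (F.frame x) (F.frame y) (F.enum x) (F.enum y) (homOfLE hx) (homOfLE hy)
  map_g x y _ _ hx hy i :=
    (transitionDet_map (F.frame x) (F.frame y) (F.enum x) (F.enum y) (homOfLE hx) (homOfLE hy)
      (homOfLE i)).trans (transitionDet_congr_hom _ _ _ _ _ _ _ _)
  g_mul _ _ _ _ _ _ _ := transitionDet_mul _ _ _ _ _ _ _ _ _
  g_self _ _ _ := transitionDet_self _ _ _

/-- The transition functions of the determinant cocycle. [folklore] -/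
lemma cocycle_g (x y : X) (V : X.Opens) (hx : V ≤ F.U x) (hy : V ≤ F.U y) :
    F.cocycle.g x y V hx hy =
      transitionDet (F.frame x) (F.frame y) (F.enum x) (F.enum y) (homOfLE hx) (homOfLE hy) :=
  rfl

/-- **Independence of the frames**: two frame systems of the same module have cohomologous
determinant cocycles, the coboundary being `λ_x = det T(e'_x, e_x)`. [folklore] -/
theorem cocycle_equiv : UnitCocycle.Equiv F.cocycle F'.cocycle :=
  ⟨{ W := fun x => F.U x ⊓ F'.U x
     mem := fun x => ⟨F.mem x, F'.mem x⟩
     le := fun x => inf_le_left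
     le' := fun x => inf_le_right
     lam := fun x V h => transitionDet (F'.frame x) (F.frame x) (F'.enum x) (F.enum x)
       (homOfLE (h.trans inf_le_right)) (homOfLE (h.trans inf_le_left))
     inv := fun x V h => transitionDet (F.frame x) (F'.frame x) (F.enum x) (F'.enum x)
       (homOfLE (h.trans inf_le_left)) (homOfLE (h.trans inf_le_right))
     map_lam := fun x V V' h i =>
       (transitionDet_map (F'.frame x) (F.frame x) (F'.enum x) (F.enum x) _ _ (homOfLE i)).trans
         (transitionDet_congr_hom _ _ _ _ _ _ _ _)
     lam_mul_inv := fun x V h => transitionDet_mul_symm _ _ _ _ _ _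
     rel := fun x y V hx hy => by
       change transitionDet (F'.frame x) (F'.frame y) _ _ _ _ * _ =
         _ * transitionDet (F.frame x) (F.frame y) _ _ _ _
       rw [transitionDet_mul, transitionDet_mul] }⟩

end FrameSystem

/-! ### The determinant class of a finite locally free module -/

section DetClass

open scoped Classical

variable (hE : IsFiniteLocallyFree E)

/-- The frame system of a finite locally free module chosen by `trivFrame`
(`Modules/LocallyFreeTrace.lean`), enumerated by `Finite.equivFin`. [folklore] -/
def frameSystemOfIsFiniteLocallyFree : FrameSystem E where
  U := trivNbhd hE
  mem := mem_trivNbhd hE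
  I := TrivIndex hE
  rank x := Nat.card (TrivIndex hE x)
  enum x := Finite.equivFin (TrivIndex hE x)
  frame := trivFrame hE

/-- **The determinant cocycle** of a finite locally free `𝒪_X`-module (with respect to the chosen
frames). [cite: Hartshorne1977, II Ex. 5.16] -/
def detCocycle : UnitCocycle X :=
  (frameSystemOfIsFiniteLocallyFree hE).cocycle

/-- **The determinant class** `[det E] ∈ Ȟ¹(X, 𝒪_X^×)` of a finite locally free `𝒪_X`-module: the
class of the line bundle `Λ^{rk E} E` (Hartshorne II Ex. 6.11, `det`), in cocycle form.
[cite: Hartshorne1977, II Ex. 6.11] -/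
def detClass : CechPic X :=
  CechPic.mk (detCocycle hE)

/-- **The determinant class can be computed in any frame system.** [folklore] -/
theorem detClass_eq_mk (F : FrameSystem E) : detClass hE = CechPic.mk F.cocycle :=
  CechPic.sound ((frameSystemOfIsFiniteLocallyFree hE).cocycle_equiv F)

/-- The determinant class does not depend on the proof of local freeness. [folklore] -/
lemma detClass_congr (hE hE' : IsFiniteLocallyFree E) : detClass hE = detClass hE' := rfl

end DetClass

end Literature.AlgebraicGeometry.Modules

end
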